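import Mathlib.RingTheory.RegularLocalRing.Polynomial
import Mathlib.RingTheory.AlgebraicIndependent.TranscendenceBasis
import Mathlib.RingTheory.KrullDimension.Field
import Mathlib.RingTheory.Ideal.Height
import Mathlib.FieldTheory.IntermediateField.Adjoin.Basic
import Mathlib.RingTheory.Valuation.ValuationSubring
import Literature.AlgebraicGeometry.Resolution.NormalizationFractions
import HarnessLib

/-!
# A regular centre of dimension two for `k(x, y)` along every valuation (`stub_regularCentre_of_purelyTranscendental`)

Stub of the birth line of the crux `ShadowsUniformize` (stmt-ResolutionOfSingularities-16756, route
`AbhyankarShadows`), regular-centre branch (lead c3, reshape #5). The branch says: if a valuation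
ring `O` of `K` contains a finitely generated model `B` (`Frac B = K`) whose local ring at the
centre `𝔪_O ∩ B` is regular of Krull dimension `≤ 2`, then relative local uniformization holds
along `O` (Abhyankar's union lemma, the neighbouring transfer stub). This file supplies such a
centre for EVERY valuation ring `O ∋ k` of the rational function field `K = k(x, y)` (`x, y`
algebraically independent over an arbitrary field `k`, `K` generated by `x, y`):

* put `x' := x` if `x ∈ O` and `x' := x⁻¹` otherwise, and `y'` likewise (`O.mem_or_inv_mem`), and
  `B := k[x', y'] = Algebra.adjoin k (range ![x', y']) ⊆ O`;
* `K = k(x', y')` (`x ∈ {x', x'⁻¹}`), so every element of `K` is a quotient of two elements of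
  `B` (`IntermediateField.mem_adjoin_iff_div`) and `Frac B = K` (`isFractionRing_adjoin_of_adjoin_eq_top`);
* hence `K` is algebraic over `B`, and since `K` contains the two algebraically independent
  elements `x, y`, the generating pair `(x', y')` of cardinality `2 ≤ trdeg_k K` is a
  transcendence basis (`Algebra.IsAlgebraic.isTranscendenceBasis_of_le_trdeg_of_finite`), in
  particular algebraically independent (`algebraicIndependent_of_adjoin_range_eq_top`);
* so `B ≅ k[X, Y]` (`AlgebraicIndependent.aevalEquiv`) is a regular ring of Krull dimension `2`
  (Mathlib: `MvPolynomial.isRegularRing_of_isRegularRing`,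
  `MvPolynomial.ringKrullDim_of_isNoetherianRing`), its localization at the (prime) centre
  `𝔪_O ∩ B` is a regular local ring (`IsRegularRing.isRegularLocalRing_localization`) of
  dimension `ht (𝔪_O ∩ B) ≤ dim B = 2` (`IsLocalization.AtPrime.ringKrullDim_eq_height`).

Everything is proved; no named facts are used.

## Sources

* O. Zariski, *The reduction of the singularities of an algebraic surface*, Ann. of Math. 40
  (1939) 639–689 (local uniformization of the plane along an arbitrary valuation: the model
  `k[x^{±1}, y^{±1}] ⊆ R_v` is the starting point). [Zariski1939]
* S. S. Abhyankar, *On the valuations centered in a local domain*, Amer. J. Math. 78 (1956)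
  321–348: Lemma 12 (the union lemma used by the neighbouring transfer stub). [Abhyankar1956Valuations]
-/

noncomputable section

-- single-problem summit: the doubled namespace component is forced
set_option linter.dupNamespace false

open Literature.AlgebraicGeometry.Resolution IsLocalRing

namespace Summit.ResolutionOfSingularities.ResolutionOfSingularities.Theorems

/-! ## Generating sets of a field extension: fractions and transcendence bases -/

/-- **Every element of `k(S)` is a quotient of two polynomial expressions in `S`.** If the field
`K` is generated over `k` by `S`, every `z ∈ K` is `a / b` with `a, b ∈ k[S]`
(`IntermediateField.mem_adjoin_iff_div`). [folklore] -/
theorem exists_div_of_adjoin_eq_top {k K : Type*} [Field k] [Field K] [Algebra k K] {S : Set K}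
    (hS : IntermediateField.adjoin k S = ⊤) (z : K) :
    ∃ a ∈ Algebra.adjoin k S, ∃ b ∈ Algebra.adjoin k S, z = a / b := by
  have hz : z ∈ IntermediateField.adjoin k S := by rw [hS]; trivial
  exact IntermediateField.mem_adjoin_iff_div.mp hz

/-- **`k[S]` presents `K = k(S)` as its field of fractions.** [folklore] -/
theorem isFractionRing_adjoin_of_adjoin_eq_top {k K : Type*} [Field k] [Field K] [Algebra k K]
    {S : Set K} (hS : IntermediateField.adjoin k S = ⊤) :
    IsFractionRing (Algebra.adjoin k S) K := by
  refine IsFractionRing.of_field (Algebra.adjoin k S) K fun z => ?_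
  obtain ⟨a, ha, b, hb, rfl⟩ := exists_div_of_adjoin_eq_top hS z
  exact ⟨⟨a, ha⟩, ⟨b, hb⟩, rfl⟩

/-- **A finite generating family of the size of an algebraically independent family is
algebraically independent.** If `K = k(v)` for a finite family `v : ι → K` and `K` contains an
algebraically independent family `w : ι → K` indexed by the same type, then `v` is algebraically
independent: `K` is algebraic over `k[v]` (it is its fraction field), and `#ι ≤ trdeg_k K`, so
`v` is a transcendence basis (`Algebra.IsAlgebraic.isTranscendenceBasis_of_le_trdeg_of_finite`).
[folklore] -/
theorem algebraicIndependent_of_adjoin_range_eq_top {k K ι : Type*} [Field k] [Field K]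
    [Algebra k K] [Finite ι] {v w : ι → K} (hw : AlgebraicIndependent k w)
    (hv : IntermediateField.adjoin k (Set.range v) = ⊤) : AlgebraicIndependent k v := by
  haveI : IsFractionRing (Algebra.adjoin k (Set.range v)) K :=
    isFractionRing_adjoin_of_adjoin_eq_top hv
  haveI : Algebra.IsAlgebraic (Algebra.adjoin k (Set.range v)) K :=
    IsLocalization.isAlgebraic _ (nonZeroDivisors (Algebra.adjoin k (Set.range v)))
  exact (Algebra.IsAlgebraic.isTranscendenceBasis_of_lift_le_trdeg_of_finite k v
    hw.lift_cardinalMk_le_trdeg).1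

/-! ## The regular centre `k[x', y'] ⊆ O` -/

/-- **Every valuation ring `O ∋ k` of `k(x, y)` has a regular centre of dimension `≤ 2` on an
affine model.** For `K = k(x, y)` with `x, y` algebraically independent over the field `k` and
any valuation ring `O` of `K` containing `k`: `B := k[x', y']` with `x' ∈ {x, x⁻¹} ∩ O`,
`y' ∈ {y, y⁻¹} ∩ O` is a finitely generated `k`-subalgebra of `O` with `Frac B = K`; `x', y'`
generate `K` and are therefore algebraically independent (transcendence degree `2`), so
`B ≅ k[X, Y]` is regular of Krull dimension `2`, and its localization at the centre `𝔪_O ∩ B` is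
a regular local ring of dimension `≤ 2`. [folklore] -/
theorem stub_regularCentre_of_purelyTranscendental (k K : Type) [Field k] [Field K] [Algebra k K]
    (x y : K) (hxy : AlgebraicIndependent k ![x, y]) (hgen : IntermediateField.adjoin k {x, y} = ⊤)
    (O : ValuationSubring K) (hk : ∀ c : k, algebraMap k K c ∈ O) :
    ∃ (B : Subalgebra k K) (h : B.toSubring ≤ O.toSubring), B.FG ∧ IsFractionRing B K ∧
      IsRegularLocalRing
        (Localization.AtPrime (Ideal.comap (Subring.inclusion h) (IsLocalRing.maximalIdeal O))) ∧
      ringKrullDim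
        (Localization.AtPrime (Ideal.comap (Subring.inclusion h) (IsLocalRing.maximalIdeal O))) ≤ 2 := by
  classical
  -- replace a generator `t ∉ O` by `t⁻¹ ∈ O`
  let f : K → K := fun t => if t ∈ O then t else t⁻¹
  have hfO : ∀ t : K, f t ∈ O := by
    intro t
    by_cases ht : t ∈ O
    · simp [f, ht]
    · simpa [f, ht] using (O.mem_or_inv_mem t).resolve_left ht
  have hfgen : ∀ (t : K) (F : IntermediateField k K), f t ∈ F → t ∈ F := by
    intro t F ht
    by_cases htO : t ∈ O
    · simpa [f, htO] using ht
    · have : t⁻¹ ∈ F := by simpa [f, htO] using ht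
      simpa using inv_mem this
  -- the model `B := k[x', y']`
  let v : Fin 2 → K := ![f x, f y]
  set B : Subalgebra k K := Algebra.adjoin k (Set.range v) with hB
  -- `B ⊆ O`
  let Oalg : Subalgebra k K := { O.toSubring with algebraMap_mem' := hk }
  have hBO' : B ≤ Oalg := by
    refine Algebra.adjoin_le ?_
    rintro _ ⟨i, rfl⟩
    fin_cases i
    · exact hfO x
    · exact hfO y
  have hBO : B.toSubring ≤ O.toSubring := fun t ht => hBO' ht
  -- `K = k(x', y')`
  have hv : IntermediateField.adjoin k (Set.range v) = ⊤ := by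
    apply top_le_iff.mp
    rw [← hgen]
    refine IntermediateField.adjoin_le_iff.mpr ?_
    refine Set.insert_subset (hfgen x _ ?_) (Set.singleton_subset_iff.mpr (hfgen y _ ?_))
    · exact IntermediateField.subset_adjoin k _ ⟨0, rfl⟩
    · exact IntermediateField.subset_adjoin k _ ⟨1, rfl⟩
  -- `x', y'` are algebraically independent: `B ≅ k[X, Y]` is regular of dimension `2`
  have hind : AlgebraicIndependent k v := algebraicIndependent_of_adjoin_range_eq_top hxy hv
  let e : MvPolynomial (Fin 2) k ≃+* B := hind.aevalEquiv.toRingEquiv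
  haveI hreg : IsRegularRing B := IsRegularRing.of_ringEquiv e
  have hdimB : ringKrullDim B = 2 := by
    rw [← ringKrullDim_eq_of_ringEquiv e, MvPolynomial.ringKrullDim_of_isNoetherianRing,
      ringKrullDim_eq_zero_of_field]
    simp
  refine ⟨B, hBO, ?_, isFractionRing_adjoin_of_adjoin_eq_top hv, ?_, ?_⟩
  · -- `B` is finitely generated
    exact Subalgebra.fg_def.mpr ⟨Set.range v, Set.finite_range v, rfl⟩
  · -- the localization of the regular ring `B` at the (prime) centre is a regular local ring
    exact IsRegularRing.isRegularLocalRing_localization _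
  · -- `dim B_𝔭 = ht 𝔭 ≤ dim B = 2`
    rw [IsLocalization.AtPrime.ringKrullDim_eq_height
      (Ideal.comap (Subring.inclusion hBO) (IsLocalRing.maximalIdeal O))
      (Localization.AtPrime (Ideal.comap (Subring.inclusion hBO) (IsLocalRing.maximalIdeal O)))]
    exact le_trans Ideal.height_le_ringKrullDim_of_isPrime hdimB.le

end Summit.ResolutionOfSingularities.ResolutionOfSingularities.Theorems

end
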